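import Summits.Ventures.HodgeRepro2.T6A2WeilLange
import Summits.Ventures.HodgeRepro2.T6A2HypLange

/-!
# T6A2WeilLangeCorner — t6-p1's Lange binders `e2 / he2 / e / he / h4` on the (S4) object `C.B.X`, by name

Cell pub-hodge-repro2, Tier 6 (README §10), seat t6-p2 (A2 owner). The three binders of t6-p1's
`alg_lefschetz_HC` / `hostIdentW` / `splitWeilAlgebraic_of_periodN` (T6A1HostBetti, STATUS l. 10992 (2)) and of
the lead's `splitWeilAlgebraic_of_clauses` (T6ShadowHost, l. 11045 (2)) — Lange's isomorphism in degrees 2 and 4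
on `ℂ ⊗ H^*(C.B.X(ℂ), ℚ)` and the degree-4 rationality clause — specialised from `T6A2WeilLange` to the
corner product `C.B` of a `CornerProduct K` (`cornerSPVar C`, an `abbrev`, so that `HC (cornerSPVar C).X 1`
IS `HC C.B.X 1`), and the binder `hL` itself from the display `Hyp.LangeBirkenhake1992_Prop1_1_20 Bd`
(`T6A2HypLange`) at `C.B` (`hL_corner`). No display is stated here; no `sorry`; standard axioms.
§8(d): uses an L-value-free non-vanishing device: NO.
-/

noncomputable section

namespace Summit.Ventures.HodgeRepro2.T6.WeilLange

open HostAPI.Carriers.AlgebraicGeometry.Motives CategoryTheory Opposite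
open scoped TensorProduct DirectSum
open WeilInst Host

section corner

variable {K : Type} [Field K] [NumberField K] [NumberField.IsCMField K] (Bd : BettiHodgeData ℂ)
  (C : CornerProduct K)

/-- the corner product `B` of the (S4) object as a smooth projective variety with its dimension -/
abbrev cornerSPVar : SPVar ℂ := ⟨C.B.X, C.B.dim, C.smooth⟩

/-- the binder `hL` of every host-side A2 file at the corner product, from the Lange display -/
theorem hL_corner (hD : Hyp.LangeBirkenhake1992_Prop1_1_20 Bd) :
    Function.Bijective (langeMap Bd.W (cornerSPVar C)) :=
  hD C.B C.smooth

/-- t6-p1's `e2 / he2` on the (S4) object: Lange in degree 2 on `HC C.B.X 1`, on `cupC11 C.B.X` -/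
theorem lange2C_corner_ιMulti (hL : Function.Bijective (langeMap Bd.W (cornerSPVar C)))
    (v : Fin 2 → HC C.B.X 1) :
    lange2C Bd (cornerSPVar C) hL (exteriorPower.ιMulti ℂ 2 v) = cupC11 C.B.X (v 0) (v 1) :=
  lange2C_ιMulti Bd (cornerSPVar C) hL v

/-- t6-p1's `e / he` on the (S4) object: Lange in degree 4 on `HC C.B.X 1`, on `cup4C` -/
theorem lange4C_corner_ιMulti (hL : Function.Bijective (langeMap Bd.W (cornerSPVar C)))
    (v : Fin 4 → HC C.B.X 1) :
    lange4C Bd (cornerSPVar C) hL (exteriorPower.ιMulti ℂ 4 v) = cup4C (v 0) (v 1) (v 2) (v 3) :=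
  lange4C_ιMulti Bd (cornerSPVar C) hL v

/-- t6-p1's `h4` on the (S4) object: the degree-4 rationality clause on `HC C.B.X (2 * 2)` -/
theorem exists_eq_sum_cup4C_corner (hL : Function.Bijective (langeMap Bd.W (cornerSPVar C)))
    (c : HC C.B.X (2 * 2)) (hc : c ∈ LinearMap.range (TensorProduct.mk ℚ ℂ (HQ C.B.X (2 * 2)) 1)) :
    ∃ (m : ℕ) (q : Fin m → ℚ) (r : Fin m → Fin 4 → HC C.B.X 1),
      (∀ i j, r i j ∈ LinearMap.range (TensorProduct.mk ℚ ℂ (HQ C.B.X 1) 1)) ∧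
        c = ∑ i, (q i : ℂ) • cup4C (r i 0) (r i 1) (r i 2) (r i 3) :=
  exists_eq_sum_cup4C Bd (cornerSPVar C) hL c hc

end corner

end Summit.Ventures.HodgeRepro2.T6.WeilLange

end
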